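import Summits.HubbardSuperconductivity.HubbardSuperconductivity.Theorems.TwistGapTgCruxGlue
import Summits.HubbardSuperconductivity.HubbardSuperconductivity.Theorems.TwistGapTgThesisToSummit

/-!
# Route `TwistGap`, assembly item `Assembly` (item `stmt-HubbardSuperconductivity-1515`)

`Assembly : TgPairMomentumRigidity → TgLowEnergyCondensation → HubbardSuperconductivity` — the two
TwistGap cruxes decide the summit: compose the landed glue `tgCruxGlue_proof`
(cruxes ⇒ `S⁺` = `TgThesis`, through route DeformationLadder's `LowEnergyRigidity`) with
`tgThesisToSummit_proof` (`S⁺` ⇒ summit, through `LadderThesis` and the Kaplan–Horsch–von der Linden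
assembly). Pure logic on landed theorems.

Sources: D. J. Scalapino, Phys. Rep. 250 (1995) 329, §2. No definition is introduced.
-/

set_option linter.dupNamespace false

namespace Summit.HubbardSuperconductivity.HubbardSuperconductivity.Theorems.TwistGap

open Summit.HubbardSuperconductivity.HubbardSuperconductivity.Theses.TwistGap

/-- **Route TwistGap's `Assembly` holds** (item `stmt-HubbardSuperconductivity-1515`):
`TgPairMomentumRigidity → TgLowEnergyCondensation → HubbardSuperconductivity`, as
`tgThesisToSummit_proof ∘ tgCruxGlue_proof`. Scalapino, Phys. Rep. 250 (1995) 329, §2.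
[cite: Scalapino1995] -/
theorem twistGap_assembly_proof : Assembly := fun hR hC =>
  tgThesisToSummit_proof (tgCruxGlue_proof hR hC)

end Summit.HubbardSuperconductivity.HubbardSuperconductivity.Theorems.TwistGap
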